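import Summits.NavierStokesRegularity.NavierStokesRegularity.Theorems.HandOverTime.Negative.HandOverTimeFalseOfEternalHyperbolicMaxSolution

/-!
# `RossbyDichotomy.HandOverTime` (stmt-NavierStokesRegularity-2922) is false modulo the WEAKER hypothesis
# `EventuallyHyperbolicMaxSolution` — one global solution whose vorticity maximum is hyperbolic for all LATE times

`--supports stmt-NavierStokesRegularity-2922`, lane `--negative-modulo EventuallyHyperbolicMaxSolution`
(refuter seat ns-typeII-critic-1, D-0081 §B). Sequel to
`HandOverTimeFalseOfEternalHyperbolicMaxSolution.lean` (hypothesis: a hyperbolic maximum point at EVERY time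
`s ≥ 0`). The observation of this file: the transient `[0, t₀]` never has to be controlled.

**Why "eventually" suffices.** `HandOverTime` quantifies over every time `t ∈ [0,T)` and promises the
hand-over inside the window `[t, t + c/‖curl u(t,x)‖]`. If one global solution has a hyperbolic maximum point
of `|curl u(s,·)|` at every time `s ≥ t₀`, run `HandOverTime` at `t := t₀` (and `T := t₀ + c/‖curl u(t₀,x₀)‖ + 1`):
the window starts at `t₀`, so it lies inside `[t₀, ∞)` whatever `c` is, and the returned hand-over time `s ≥ t₀`
carries a hyperbolic maximum point — contradiction. Hence
`handOverTime_false_of_eventuallyHyperbolicMaxSolution`, and the eternal lemma is the special case `t₀ = 0`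
(`eventuallyHyperbolicMaxSolution_of_eternal`).

**Why this is the modulus to construct.** The eventual form is what the printed LONG-TIME ASYMPTOTICS of
decaying Navier–Stokes flows would deliver, with no condition on the datum's own vorticity maximum: for small
rapidly decaying data the solution is global and smooth, and its first-order large-time profile is an explicit
combination of derivatives of the heat kernel weighted by moments of the datum and of the nonlinearity
(Fujigaki–Miyakawa, *Asymptotic profiles of nonstationary incompressible Navier–Stokes flows in the whole
space*, SIAM J. Math. Anal. 33 (2001) 523–544; survey: Brandolese–Schonbek, *Large time behavior of the
Navier–Stokes flow*, Handbook of Math. Analysis in Mech. of Viscous Fluids (2016)). The item's own evidence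
record (refuter route-review, 2026-08-15, `HandOverTime_SuspectFalse.md`) computes that for an open set of
moment parameters this profile has a UNIQUE global vorticity maximum that is strictly hyperbolic — if that
computation is right, a `C¹`-level (velocity-gradient, weighted-`L^∞`) version of the asymptotic expansion makes
the true solution's vorticity maximum hyperbolic for all `t ≥ t₀`, i.e. it proves `EventuallyHyperbolicMaxSolution`.
What the tree lacks for that construction: (i) small-data global existence as a THEOREM producing
`IsClassicalNSSolutionOn` / `IsLerayHopfOn` (these are predicates here, with no existence theorem), and (ii) the
gradient-level asymptotic profile with a rate. Neither is small, hence again the `--negative-modulo` lane: NO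
verdict change on 2922 (it stays open, held); the hypothesis is filed as a construction item, and it is implied
by (so at most as hard as) `EternalHyperbolicMaxSolution`.
-/

noncomputable section

open Set

-- justification: the namespace is fixed by the negative-lemma protocol (`Theorems/<Decl>/Negative/`).
set_option linter.dupNamespace false

namespace Summit.NavierStokesRegularity.NavierStokesRegularity.Theorems.HandOverTime.Negative

/-! ### The hypothesis -/

/-- **Hypothesis `EventuallyHyperbolicMaxSolution` (NOT constructible in the tree; filed `--negative-modulo`).**
There are a viscosity `ν > 0` and a global classical solution `(u, p)` of unforced Navier–Stokes on `ℝ³` —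
classical on every slab `[0,T)`, Leray–Hopf on every `[0,T)` from its datum `u 0`, the datum rapidly decaying
(exactly the solution class of the crux `HandOverTime`) — and a time `t₀ ≥ 0` such that at every time `s ≥ t₀`
some maximum point `x` of `‖curl (u s) ·‖` is HYPERBOLIC: some unit vector `e` has
`½‖curl (u s) x‖ < |⟪e, D(u s)(x) e⟫|`. (The eternal hypothesis of the sibling file is the case `t₀ = 0`.) -/
def EventuallyHyperbolicMaxSolution : Prop :=
  ∃ (ν : ℝ) (u : ℝ → EuclideanSpace ℝ (Fin 3) → EuclideanSpace ℝ (Fin 3))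
    (p : ℝ → EuclideanSpace ℝ (Fin 3) → ℝ), 0 < ν ∧
    Literature.Analysis.FluidPDE.HasRapidSpatialDecay (u 0) ∧
    (∀ T : ℝ, 0 < T →
      Literature.Analysis.FluidPDE.IsClassicalNSSolutionOn (Set.Ico 0 T) ν 0 u p ∧
      Literature.Analysis.FluidPDE.IsLerayHopfOn T ν 0 (u 0) u) ∧
    ∃ t₀ : ℝ, 0 ≤ t₀ ∧ ∀ s : ℝ, t₀ ≤ s → ∃ x : EuclideanSpace ℝ (Fin 3),
      (∀ y, ‖Literature.Analysis.FluidPDE.curl (u s) y‖ ≤ ‖Literature.Analysis.FluidPDE.curl (u s) x‖) ∧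
      ∃ e : EuclideanSpace ℝ (Fin 3), ‖e‖ = 1 ∧
        (1 / 2 : ℝ) * ‖Literature.Analysis.FluidPDE.curl (u s) x‖ < |inner ℝ e (fderiv ℝ (u s) x e)|

/-- The eternal hypothesis implies the eventual one (`t₀ = 0`). -/
theorem eventuallyHyperbolicMaxSolution_of_eternal (h : EternalHyperbolicMaxSolution) :
    EventuallyHyperbolicMaxSolution := by
  obtain ⟨ν, u, p, hν, hdec, hsol, hhyp⟩ := h
  exact ⟨ν, u, p, hν, hdec, hsol, 0, le_rfl, hhyp⟩

/-! ### The negative lemma -/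

/-- **`HandOverTime` is false modulo `EventuallyHyperbolicMaxSolution`.** Given the universal constant `c` of
`HandOverTime`, run it on the solution restricted to `[0, T)`, `T := t₀ + c/‖curl (u t₀) x₀‖ + 1`, at `t = t₀`
and the hyperbolic maximum point `x₀` of time `t₀`: the returned hand-over time lies in
`[t₀, t₀ + c/‖curl (u t₀) x₀‖] ⊆ [t₀, ∞)`, where the hypothesis supplies a hyperbolic maximum point —
contradiction with "every maximum point is elliptic" (Lean's `c / 0 = 0` makes a vanishing maximum harmless). -/
theorem handOverTime_false_of_eventuallyHyperbolicMaxSolution :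
    EventuallyHyperbolicMaxSolution →
      ¬ Summit.NavierStokesRegularity.NavierStokesRegularity.Theses.RossbyDichotomy.HandOverTime := by
  rintro ⟨ν, u, p, hν, hdec, hsol, t₀, ht₀, hhyp⟩ ⟨c, hc, hand⟩
  -- the hyperbolic maximum point at time `t₀`
  obtain ⟨x₀, hmax₀, e₀, he₀, hhyp₀⟩ := hhyp t₀ le_rfl
  set T : ℝ := t₀ + c / ‖Literature.Analysis.FluidPDE.curl (u t₀) x₀‖ + 1 with hT
  have hwin : 0 ≤ c / ‖Literature.Analysis.FluidPDE.curl (u t₀) x₀‖ :=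
    div_nonneg hc.le (norm_nonneg _)
  have hTpos : 0 < T := by rw [hT]; linarith
  obtain ⟨hcl, hLH⟩ := hsol T hTpos
  have ht0T : t₀ ∈ Set.Ico 0 T := ⟨ht₀, by rw [hT]; linarith⟩
  have hlt : t₀ + c / ‖Literature.Analysis.FluidPDE.curl (u t₀) x₀‖ < T := by rw [hT]; linarith
  obtain ⟨s, hs, hell⟩ := hand ν T hν hTpos u p hcl hLH hdec t₀ ht0T x₀ hmax₀ ⟨e₀, he₀, hhyp₀⟩ hlt
  -- at the hand-over time `s ≥ t₀` the hypothesis gives a hyperbolic maximum point: contradiction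
  obtain ⟨x', hmax', e', he', hhyp'⟩ := hhyp s hs.1
  exact absurd (hell x' hmax' e' he') (not_le.mpr hhyp')

/-- The sibling file's eternal lemma is recovered as the special case `t₀ = 0` (no new declaration). -/
example : EternalHyperbolicMaxSolution →
    ¬ Summit.NavierStokesRegularity.NavierStokesRegularity.Theses.RossbyDichotomy.HandOverTime :=
  fun h => handOverTime_false_of_eventuallyHyperbolicMaxSolution
    (eventuallyHyperbolicMaxSolution_of_eternal h)

end Summit.NavierStokesRegularity.NavierStokesRegularity.Theorems.HandOverTime.Negative
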